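import Summits.Parity.GeneralizedHardyLittlewood.Theorems.LiouvilleShiftedTablesDefs
import Literature.NumberTheory.Sieve.DrappeauDispersionMainKernelLiouville
import Literature.NumberTheory.Sieve.DrappeauDispersionLemmas
import Literature.NumberTheory.LFunctions.MontgomeryOffDiagonalTools

/-!
# Main terms of the line `peel-to-drappeau` (crux `TypeI2Dilated`, stmt-Parity-14272) — I: one block

`stub_mainTerms : MainTermsStep := BVLiouville → DilatedMainTerms` (vocabulary in
`Theorems/LiouvilleShiftedTablesDefs.lean`).  One term of `DilatedMainTerms` is, for a triple `(P, q, r)` with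
`r̃ = rP`, the block

`I = ∑_{s ∈ sRange c q r̃ Slo S} ∑_{m ≤ Y, m ≡ a₁ (r̃), m ≡ a₂ (q)} λ(m) K_{Rd}(m c̄; s)`.

This file reduces `‖I‖` to the class sums against primitive characters of the Literature file
`DrappeauDispersionMainKernelLiouville` (`norm_sum_class_liouville_mainKernel_le`): the two classes are one class
`e mod L`, `L = lcm(q, r̃)`, or the block vanishes (`Drappeau2017.crt_reduce`), whence

* `mainBlock_le` — `∃ e, ‖I‖ ≤ ∑_{(f,ψ*), f ≤ Rd} ∑_{d ≤ S} ω(f, d) · G(e; ψ*, d)` with the weights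
  `omegaW c q r̃ Slo S f d = ∑_{s ∈ sRange, f ∣ s, d ∣ s} φ(s)⁻¹` and
  `G = classCharNorm L e (f, ψ*) d ⌊Y⌋ = ‖∑_{t ≤ ⌊Y⌋/d, dt ≡ e (L)} λ(t)ψ*(t)‖`;
* the weight bounds `omegaW_le_div_totient_left/right` (`ω(f,d) ≤ W/φ(f)`, `ω(f,d) ≤ W/φ(d)`,
  `W = 7 + 12 log ⌊S⌋`, by `φ(ab) ≥ φ(a)φ(b)` and `∑_{s ≤ S} 1/φ(s) ≤ 7 + 12 log S`), `omegaW_nonneg`, and the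
  support property `omegaW_eq_zero_of_not_coprime` (`ω(f, d) = 0` unless `(d, q r̃) = 1`).
-/

noncomputable section

namespace Summit.Parity.GeneralizedHardyLittlewood.Cruxes.TypeI2Dilated.PeelToDrappeau

open Finset Real Complex
open scoped ArithmeticFunction.sigma Classical
open Literature.NumberTheory.Sieve Literature.NumberTheory.Sieve.Drappeau2017
open ArithmeticFunction (liouville)

/-! ### The weights and the class sums -/

/-- The weight `ω(f, d) = ∑_{s ∈ sRange c q r̃ Slo S, f ∣ s, d ∣ s} φ(s)⁻¹` of the pair (conductor `f`,
Möbius divisor `d`) in the reduction of one block. [this line] -/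
def omegaW (c : ℤ) (q r : ℕ) (Slo S : ℝ) (f d : ℕ) : ℝ :=
  ∑ s ∈ (sRange c q r Slo S).filter (fun s => f ∣ s ∧ d ∣ s), ((Nat.totient s : ℝ))⁻¹

/-- The class sum against a primitive character: `G = ‖∑_{t ≤ N/d, dt ≡ e (L)} λ(t) ψ*(t)‖` for the pair
`p = (f, ψ*)`. [this line] -/
def classCharNorm (L : ℕ) (e : ZMod L) (p : Σ f : ℕ, DirichletCharacter ℂ f) (d N : ℕ) : ℝ :=
  ‖∑ t ∈ (Icc 1 (N / d)).filter (fun t : ℕ => ((d * t : ℕ) : ZMod L) = e),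
      ((liouville t : ℤ) : ℂ) * p.2 (t : ZMod p.1)‖

/-- `ω(f, d) ≥ 0`. [this line] -/
theorem omegaW_nonneg (c : ℤ) (q r : ℕ) (Slo S : ℝ) (f d : ℕ) : 0 ≤ omegaW c q r Slo S f d :=
  sum_nonneg fun _ _ => inv_nonneg.2 (Nat.cast_nonneg _)

/-- `G ≥ 0`. [this line] -/
theorem classCharNorm_nonneg (L : ℕ) (e : ZMod L) (p : Σ f : ℕ, DirichletCharacter ℂ f) (d N : ℕ) :
    0 ≤ classCharNorm L e p d N := norm_nonneg _

/-- `sRange ⊆ [1, ⌊S⌋]`. [this line] -/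
theorem sRange_subset_Icc (c : ℤ) (q r : ℕ) (Slo S : ℝ) : sRange c q r Slo S ⊆ Icc 1 ⌊S⌋₊ :=
  filter_subset _ _

/-- Support of the weights: `ω(f, d) = 0` unless `(d, q r̃) = 1` (every `s ∈ sRange` is coprime to `q r̃`).
[this line] -/
theorem omegaW_eq_zero_of_not_coprime (c : ℤ) {q r : ℕ} (Slo S : ℝ) (f : ℕ) {d : ℕ}
    (hd : ¬ d.Coprime (q * r)) : omegaW c q r Slo S f d = 0 := by
  unfold omegaW
  refine sum_eq_zero fun s hs => ?_
  exfalso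
  rw [mem_filter] at hs
  obtain ⟨hsR, -, hds⟩ := hs
  unfold sRange at hsR
  rw [mem_filter] at hsR
  exact hd (Nat.Coprime.coprime_dvd_left hds hsR.2.2.1)

/-! ### One block: CRT and the Literature reduction -/

/-- **One block of `DilatedMainTerms`, reduced to class sums against primitive characters.**  For `q, r̃ ≥ 1`
there is a class `e mod lcm(q, r̃)` (irrelevant when the two classes are incompatible) with
`‖∑_{s ∈ sRange} ∑_{m ≤ Y, m ≡ a₁ (r̃), m ≡ a₂ (q)} λ(m) K_{Rd}(m c̄; s)‖ ≤ ∑_{(f,ψ*), f ≤ Rd} ∑_{d ≤ S} ω(f,d) G(e; ψ*, d)`.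
[this line] -/
theorem mainBlock_le (c : ℤ) (q r : ℕ) (a₁ a₂ : ℤ) (Slo S Y Rd : ℝ) :
    ∃ e : ZMod (Nat.lcm q r),
      ‖∑ s ∈ sRange c q r Slo S,
          ∑ m ∈ (Icc 1 ⌊Y⌋₊).filter (fun m : ℕ =>
              (m : ZMod r) = ((a₁ : ℤ) : ZMod r) ∧ (m : ZMod q) = ((a₂ : ℤ) : ZMod q)),
            ((liouville m : ℤ) : ℂ) * mainKernel Rd s ((m : ZMod s) * ((c : ZMod s))⁻¹)‖ ≤
        ∑ p ∈ primIndexLe ⌊Rd⌋₊, ∑ d ∈ Icc 1 ⌊S⌋₊,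
          omegaW c q r Slo S p.1 d * classCharNorm (Nat.lcm q r) e p d ⌊Y⌋₊ := by
  have hRHS0 : ∀ e : ZMod (Nat.lcm q r), 0 ≤ ∑ p ∈ primIndexLe ⌊Rd⌋₊, ∑ d ∈ Icc 1 ⌊S⌋₊,
      omegaW c q r Slo S p.1 d * classCharNorm (Nat.lcm q r) e p d ⌊Y⌋₊ := fun e =>
    sum_nonneg fun p _ => sum_nonneg fun d _ =>
      mul_nonneg (omegaW_nonneg c q r Slo S p.1 d) (classCharNorm_nonneg _ e p d _)
  rcases crt_reduce (q := q) (r := r) a₁ a₂ with hnone | ⟨e, he⟩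
  · -- incompatible classes: the block vanishes
    refine ⟨0, ?_⟩
    have hempty : ∀ s : ℕ, ∑ m ∈ (Icc 1 ⌊Y⌋₊).filter (fun m : ℕ =>
        (m : ZMod r) = ((a₁ : ℤ) : ZMod r) ∧ (m : ZMod q) = ((a₂ : ℤ) : ZMod q)),
          ((liouville m : ℤ) : ℂ) * mainKernel Rd s ((m : ZMod s) * ((c : ZMod s))⁻¹) = 0 := by
      intro s
      refine sum_eq_zero fun m hm => ?_
      exfalso
      exact hnone m (mem_filter.1 hm).2
    rw [sum_congr rfl fun s _ => hempty s, sum_const_zero, norm_zero]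
    exact hRHS0 0
  · refine ⟨(e : ZMod (Nat.lcm q r)), ?_⟩
    have hfilt : (Icc 1 ⌊Y⌋₊).filter (fun m : ℕ =>
        (m : ZMod r) = ((a₁ : ℤ) : ZMod r) ∧ (m : ZMod q) = ((a₂ : ℤ) : ZMod q)) =
        (Icc 1 ⌊Y⌋₊).filter (fun m : ℕ => (m : ZMod (Nat.lcm q r)) = ((e : ℕ) : ZMod (Nat.lcm q r))) :=
      filter_congr fun m _ => he m
    simp_rw [hfilt]
    refine (norm_sum_class_liouville_mainKernel_le c ((e : ℕ) : ZMod (Nat.lcm q r)) Rd ⌊Y⌋₊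
      (sRange_subset_Icc c q r Slo S)).trans ?_
    rfl

/-! ### Weight bounds -/

/-- `W(S) = 7 + 12 log ⌊S⌋`, the bound for `∑_{s ≤ S} 1/φ(s)`. [this line] -/
def weightW (S : ℝ) : ℝ := 7 + 12 * Real.log (⌊S⌋₊ : ℝ)

/-- `∑_{1 ≤ s ≤ ⌊S⌋} 1/φ(s) ≤ W(S)` (the tree's `sum_Icc_inv_totient_le`). [folklore] -/
theorem sum_inv_totient_le_weightW (S : ℝ) :
    ∑ s ∈ Icc 1 ⌊S⌋₊, ((Nat.totient s : ℝ))⁻¹ ≤ weightW S := by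
  have h := Literature.NumberTheory.LFunctions.Montgomery.sum_Icc_inv_totient_le ⌊S⌋₊
  simp_rw [one_div] at h
  exact h

/-- `W(S) ≥ 7 > 0` for `S` with `⌊S⌋ ≥ 1`, and in general `0 ≤ ∑ ≤ W`; we record `0 ≤ W(S)` when `1 ≤ ⌊S⌋`.
[this line] -/
theorem weightW_nonneg {S : ℝ} (hS : 1 ≤ ⌊S⌋₊) : 0 ≤ weightW S := by
  unfold weightW
  have : 0 ≤ Real.log (⌊S⌋₊ : ℝ) := Real.log_nonneg (by exact_mod_cast hS)
  linarith

/-- The weight restricted to multiples of `n`: `∑_{s ≤ S, n ∣ s} 1/φ(s) ≤ W(S)/φ(n)` (`φ(n s') ≥ φ(n)φ(s')`).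
[folklore] -/
theorem sum_inv_totient_filter_dvd_le {n : ℕ} (hn : 0 < n) (S : ℝ) :
    ∑ s ∈ (Icc 1 ⌊S⌋₊).filter (fun s => n ∣ s), ((Nat.totient s : ℝ))⁻¹ ≤
      weightW S / Nat.totient n := by
  have hφn : (0 : ℝ) < Nat.totient n := by exact_mod_cast Nat.totient_pos.2 hn
  rw [sum_filter_dvd_Icc_eq hn ⌊S⌋₊ fun s => ((Nat.totient s : ℝ))⁻¹]
  calc ∑ t ∈ Icc 1 (⌊S⌋₊ / n), ((Nat.totient (n * t) : ℝ))⁻¹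
      ≤ ∑ t ∈ Icc 1 (⌊S⌋₊ / n), ((Nat.totient n : ℝ))⁻¹ * ((Nat.totient t : ℝ))⁻¹ := by
        refine sum_le_sum fun t ht => ?_
        have ht0 : 0 < t := (mem_Icc.1 ht).1
        have hφt : (0 : ℝ) < Nat.totient t := by exact_mod_cast Nat.totient_pos.2 ht0
        rw [← mul_inv]
        refine inv_anti₀ (mul_pos hφn hφt) ?_
        exact_mod_cast Nat.totient_super_multiplicative n t
    _ = ((Nat.totient n : ℝ))⁻¹ * ∑ t ∈ Icc 1 (⌊S⌋₊ / n), ((Nat.totient t : ℝ))⁻¹ := by rw [mul_sum]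
    _ ≤ ((Nat.totient n : ℝ))⁻¹ * weightW S := by
        refine mul_le_mul_of_nonneg_left ?_ (inv_nonneg.2 hφn.le)
        refine le_trans ?_ (sum_inv_totient_le_weightW S)
        refine sum_le_sum_of_subset_of_nonneg (Icc_subset_Icc_right (Nat.div_le_self _ _)) ?_
        exact fun _ _ _ => inv_nonneg.2 (Nat.cast_nonneg _)
    _ = weightW S / Nat.totient n := by rw [div_eq_inv_mul]

/-- **`ω(f, d) ≤ W(S)/φ(f)`** for `f ≥ 1`. [this line] -/
theorem omegaW_le_div_totient_left (c : ℤ) (q r : ℕ) (Slo S : ℝ) {f : ℕ} (hf : 0 < f) (d : ℕ) :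
    omegaW c q r Slo S f d ≤ weightW S / Nat.totient f := by
  unfold omegaW
  refine le_trans ?_ (sum_inv_totient_filter_dvd_le hf S)
  refine sum_le_sum_of_subset_of_nonneg ?_ fun _ _ _ => inv_nonneg.2 (Nat.cast_nonneg _)
  intro s hs
  rw [mem_filter] at hs ⊢
  exact ⟨sRange_subset_Icc c q r Slo S hs.1, hs.2.1⟩

/-- **`ω(f, d) ≤ W(S)/φ(d)`** for `d ≥ 1`. [this line] -/
theorem omegaW_le_div_totient_right (c : ℤ) (q r : ℕ) (Slo S : ℝ) (f : ℕ) {d : ℕ} (hd : 0 < d) :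
    omegaW c q r Slo S f d ≤ weightW S / Nat.totient d := by
  unfold omegaW
  refine le_trans ?_ (sum_inv_totient_filter_dvd_le hd S)
  refine sum_le_sum_of_subset_of_nonneg ?_ fun _ _ _ => inv_nonneg.2 (Nat.cast_nonneg _)
  intro s hs
  rw [mem_filter] at hs ⊢
  exact ⟨sRange_subset_Icc c q r Slo S hs.1, hs.2.2⟩

/-- Support of the weights in the conductor: `ω(f, d) = 0` unless `(f, q r̃) = 1`. [this line] -/
theorem omegaW_eq_zero_of_not_coprime_left (c : ℤ) {q r : ℕ} (Slo S : ℝ) {f : ℕ} (d : ℕ)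
    (hf : ¬ f.Coprime (q * r)) : omegaW c q r Slo S f d = 0 := by
  unfold omegaW
  refine sum_eq_zero fun s hs => ?_
  exfalso
  rw [mem_filter] at hs
  obtain ⟨hsR, hfs, -⟩ := hs
  unfold sRange at hsR
  rw [mem_filter] at hsR
  exact hf (Nat.Coprime.coprime_dvd_left hfs hsR.2.2.1)

/-- `W(S) ≥ 0` unconditionally (`log n ≥ 0` for `n : ℕ`). [this line] -/
theorem weightW_nonneg' (S : ℝ) : 0 ≤ weightW S := by
  unfold weightW
  have : 0 ≤ Real.log (⌊S⌋₊ : ℝ) := Real.log_natCast_nonneg _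
  linarith

/-! ### Splitting the reduced block into the three ranges -/

/-- `∑_p ∑_d = ∑_p ∑_{d > D₀} + ∑_{p, P p} ∑_{d ≤ D₀} + ∑_{p, ¬P p} ∑_{d ≤ D₀}`. [folklore] -/
theorem sum_sum_split_three {α : Type*} (s : Finset α) (t : Finset ℕ) (F : α → ℕ → ℝ) (P : α → Prop)
    [DecidablePred P] (D₀ : ℕ) :
    ∑ a ∈ s, ∑ d ∈ t, F a d =
      ∑ a ∈ s, ∑ d ∈ t.filter (fun d => D₀ < d), F a d +
        ∑ a ∈ s.filter P, ∑ d ∈ t.filter (fun d => d ≤ D₀), F a d +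
          ∑ a ∈ s.filter (fun a => ¬ P a), ∑ d ∈ t.filter (fun d => d ≤ D₀), F a d := by
  have h1 : ∀ a, ∑ d ∈ t, F a d =
      ∑ d ∈ t.filter (fun d => D₀ < d), F a d + ∑ d ∈ t.filter (fun d => d ≤ D₀), F a d := by
    intro a
    rw [← sum_filter_add_sum_filter_not t (fun d => D₀ < d)]
    congr 1
    exact sum_congr (filter_congr fun d _ => by simp [not_lt]) fun _ _ => rfl
  simp_rw [h1, sum_add_distrib]
  rw [add_assoc, ← sum_filter_add_sum_filter_not s P (fun a => ∑ d ∈ t.filter (fun d => d ≤ D₀), F a d)]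

/-! ### Range (i): large Möbius divisor `d > D₀` — trivial bound -/

/-- One term with `d > D₀`: `ω(f,d) G ≤ (W/φ(d)) (N/(D₀ L) + 1)` (`G ≤ N/(dL) + 1` when `(d, q r̃) = 1`, and
`ω = 0` otherwise). [this line] -/
theorem omegaW_mul_classCharNorm_le_far (c : ℤ) {q r : ℕ} (hq : 0 < q) (hr : 0 < r) (Slo S : ℝ)
    (e : ZMod (Nat.lcm q r)) (p : Σ f : ℕ, DirichletCharacter ℂ f) {d D₀ : ℕ} (hD₀ : 0 < D₀) (hd : D₀ < d)
    (N : ℕ) :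
    omegaW c q r Slo S p.1 d * classCharNorm (Nat.lcm q r) e p d N ≤
      weightW S / Nat.totient d * ((N : ℝ) / (D₀ * Nat.lcm q r) + 1) := by
  have hd0 : 0 < d := hD₀.trans hd
  have hL : 0 < Nat.lcm q r := Nat.lcm_pos hq hr
  have hL0 : (0 : ℝ) < Nat.lcm q r := by exact_mod_cast hL
  have hD₀0 : (0 : ℝ) < D₀ := by exact_mod_cast hD₀
  have hφd : (0 : ℝ) < Nat.totient d := by exact_mod_cast Nat.totient_pos.2 hd0
  have hRHS : 0 ≤ weightW S / Nat.totient d * ((N : ℝ) / (D₀ * Nat.lcm q r) + 1) :=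
    mul_nonneg (div_nonneg (weightW_nonneg' S) hφd.le) (by positivity)
  by_cases hcop : d.Coprime (q * r)
  · have hdL : d.Coprime (Nat.lcm q r) := Nat.Coprime.coprime_dvd_right (Nat.lcm_dvd_mul q r) hcop
    refine mul_le_mul (omegaW_le_div_totient_right c q r Slo S p.1 hd0) ?_ (classCharNorm_nonneg _ _ _ _ _)
      (div_nonneg (weightW_nonneg' S) hφd.le)
    unfold classCharNorm
    refine (norm_sum_filter_mul_char_le_card hL hdL e (N / d) p.2).trans ?_
    gcongr
    -- `((N/d)/L : ℕ) ≤ N/(D₀ L)`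
    rw [le_div_iff₀ (mul_pos hD₀0 hL0)]
    have h1 : ((N / d / Nat.lcm q r : ℕ) : ℝ) * Nat.lcm q r ≤ (N / d : ℕ) := by
      exact_mod_cast Nat.div_mul_le_self (N / d) (Nat.lcm q r)
    have h2 : ((N / d : ℕ) : ℝ) * d ≤ N := by exact_mod_cast Nat.div_mul_le_self N d
    have h3 : (D₀ : ℝ) ≤ d := by exact_mod_cast hd.le
    have h4 : (0 : ℝ) ≤ (N / d / Nat.lcm q r : ℕ) := Nat.cast_nonneg _
    calc ((N / d / Nat.lcm q r : ℕ) : ℝ) * (D₀ * Nat.lcm q r)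
        = (((N / d / Nat.lcm q r : ℕ) : ℝ) * Nat.lcm q r) * D₀ := by ring
      _ ≤ ((N / d : ℕ) : ℝ) * D₀ := by gcongr
      _ ≤ ((N / d : ℕ) : ℝ) * d := by gcongr
      _ ≤ N := h2
  · rw [omegaW_eq_zero_of_not_coprime c Slo S p.1 hcop, zero_mul]
    exact hRHS

/-- **Range (i), one triple.**  `∑_{p} ∑_{D₀ < d ≤ S} ω(f,d) G ≤ #S(≤Rd) · W² · (N/(D₀ L) + 1)`. [this line] -/
theorem range_i_le (c : ℤ) {q r : ℕ} (hq : 0 < q) (hr : 0 < r) (Slo S : ℝ) (e : ZMod (Nat.lcm q r))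
    (K : ℕ) {D₀ : ℕ} (hD₀ : 0 < D₀) (N : ℕ) :
    ∑ p ∈ primIndexLe K, ∑ d ∈ (Icc 1 ⌊S⌋₊).filter (fun d => D₀ < d),
        omegaW c q r Slo S p.1 d * classCharNorm (Nat.lcm q r) e p d N ≤
      (primIndexLe K).card * (weightW S ^ 2 * ((N : ℝ) / (D₀ * Nat.lcm q r) + 1)) := by
  have hL : 0 < Nat.lcm q r := Nat.lcm_pos hq hr
  have hX : 0 ≤ (N : ℝ) / (D₀ * Nat.lcm q r) + 1 := by positivity
  have hW := weightW_nonneg' S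
  have hinner : ∀ p ∈ primIndexLe K, ∑ d ∈ (Icc 1 ⌊S⌋₊).filter (fun d => D₀ < d),
      omegaW c q r Slo S p.1 d * classCharNorm (Nat.lcm q r) e p d N ≤
        weightW S ^ 2 * ((N : ℝ) / (D₀ * Nat.lcm q r) + 1) := by
    intro p _
    calc ∑ d ∈ (Icc 1 ⌊S⌋₊).filter (fun d => D₀ < d),
          omegaW c q r Slo S p.1 d * classCharNorm (Nat.lcm q r) e p d N
        ≤ ∑ d ∈ (Icc 1 ⌊S⌋₊).filter (fun d => D₀ < d),
            weightW S / Nat.totient d * ((N : ℝ) / (D₀ * Nat.lcm q r) + 1) :=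
          sum_le_sum fun d hd => omegaW_mul_classCharNorm_le_far c hq hr Slo S e p hD₀ (mem_filter.1 hd).2 N
      _ ≤ ∑ d ∈ Icc 1 ⌊S⌋₊, weightW S / Nat.totient d * ((N : ℝ) / (D₀ * Nat.lcm q r) + 1) := by
          refine sum_le_sum_of_subset_of_nonneg (filter_subset _ _) fun d _ _ => ?_
          exact mul_nonneg (div_nonneg hW (Nat.cast_nonneg _)) hX
      _ = (weightW S * ((N : ℝ) / (D₀ * Nat.lcm q r) + 1)) *
            ∑ d ∈ Icc 1 ⌊S⌋₊, ((Nat.totient d : ℝ))⁻¹ := by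
          rw [mul_sum]
          refine sum_congr rfl fun d _ => ?_
          rw [div_eq_mul_inv]; ring
      _ ≤ (weightW S * ((N : ℝ) / (D₀ * Nat.lcm q r) + 1)) * weightW S :=
          mul_le_mul_of_nonneg_left (sum_inv_totient_le_weightW S) (mul_nonneg hW hX)
      _ = weightW S ^ 2 * ((N : ℝ) / (D₀ * Nat.lcm q r) + 1) := by ring
  refine (sum_le_sum hinner).trans ?_
  rw [sum_const, nsmul_eq_mul]

/-- Landing anchor of the main-terms chain, file 2 (one block: reduction, weights, range (i)); registered stub
`mainTermsChain2_anchor` of the crux item. -/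
theorem mainTermsChain2_anchor : True := trivial

end Summit.Parity.GeneralizedHardyLittlewood.Cruxes.TypeI2Dilated.PeelToDrappeau

end
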